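import Literature.Topology.FourManifolds.TraceCollarProfile
import Mathlib.Analysis.SpecialFunctions.SmoothTransition
import Mathlib.Analysis.Complex.ExponentialBounds

/-!
# The corner-turning profile of the end collar of a slice-disc exterior

Topic `Literature/Topology/FourManifolds`; second "profile" file (after `TraceCollarProfile.lean`) of the
fact seat of `Literature.Topology.FourManifolds.Knot.ManolescuPiccirillo2023_lemma33_sphere`, serving the
named fact `Literature.Topology.FourManifolds.Knot.IsSliceDisc.exists_endCollar_of_isIntegralSurgery_zero`
(`ZeroSurgeryHomotopyBallSliceConstruction.lean`: the end of the exterior `B̊⁴ ∖ Δ` of a slice disc is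
collared by the `0`-surgery, Gompf–Stipsicz (1999), §6.2 / Kirby (1989), Ch. I §5). Everything here is
pure real analysis and is proved.

Near the corner circle `K = ∂Δ ⊂ 𝕊³` a point of `B̊⁴ ∖ Δ` close to `𝕊³ ∪ Δ` has two size coordinates: the
**depth** `ℓ = 1 - ‖z‖ ∈ (0, 1)` into the ball (measured along the disc, `ℓ → 1` at its centre) and the
**normal radius** `r ∈ (0, 2)` (distance from `Δ` in a tube `Δ × B(0,2)`). The collar lines must run
from the end (`ℓ → 0`, the sphere, or `r → 0`, the disc) to the frontier of a compact core
`K₀ = {ℓ ≥ s, r ≥ 1}`. This file constructs the 2-dimensional profile diffeomorphism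

  `Ψ = (τ, h) : P(s) = (0,1) × (0,2) ∖ ([s,1) × [1,2)) ⟶ (0, 2) × ℝ`

(`Literature.Topology.FourManifolds.SliceCollar.Ψ`, for a parameter `0 < s < 1`), where `τ` will be the
tube-radius coordinate of the `0`-surgery `Y = (S³ ∖ K) ∪ (D̊² × 𝕊¹)` and `h = σ` the collar height:

* **edge functions** `E c t = ψ(1/t - 1/c)` (`ψ(Y) = e^{Y - 1/Y}` of `TraceCollarProfile.lean`; smooth on
  `t > 0`, `→ +∞` as `t → 0⁺`, strictly decreasing on `(0, c]`, flat `0` on `[c, ∞)`), with the explicit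
  inverse `Einv c q = 1/(ψinv q + 1/c)`;
* **height** `h = -log (E_s(ℓ) + E_1(r))` (`→ -∞` at the end, `→ +∞` at the core), **angle**
  `θ = E_1(r)/(E_s(ℓ) + E_1(r)) ∈ [0, 1]` along its level curves, smooth step `β = smoothTransition(2θ - 1/2)`;
* **tube-radius coordinate** `τ = (1 - β) R(r) + β T(ℓ)` interpolating the *radius rule*
  `R(r) = r + expNegInvGlue(1 - r)` (`= r` for `r ≥ 1`, increasing, `> 1/e`) and the *disc rule*
  `T(ℓ) = (1 - ℓ)/4` (`< 1/4 < 1/e`);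
* **closed forms**: `Ψ = (R r, -log E_s ℓ)` for `r ≥ 1` (right regime: radial lines) and
  `Ψ = (T ℓ, -log E_1 r)` for `ℓ ≥ s` (deep regime: normal rays), hence for the inverse
  `Ψ⁻¹(t, σ) = (Einv s e^{-σ}, t)` for `t ≥ 1` and `= (1 - 4t, Einv 1 e^{-σ})` for `t ≤ (1 - s)/4`
  (`Ψinv_of_one_le`, `Ψinv_of_le`);
* `det_neg`: the Jacobian `τ_ℓ h_r - τ_r h_ℓ` is negative (signs `h_ℓ, h_r, τ_r ≥ 0 ≥ τ_ℓ`, with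
  `τ_r ≥ (1-β)R' > 0` unless `β = 1`, where `τ_ℓ = -1/4`); `injOn_Ψ` (the three regimes have disjoint
  `τ`-ranges, and in the corner `τ` is strictly monotone along the level graphs `r = Einv 1 (c - E_s ℓ)` of
  `h`, by the mean value theorem); `image_Ψ_eq : Ψ '' P(s) = (0,2) × ℝ` (open by the inverse function
  theorem, relatively closed since `h → ∓∞` exactly at the end and at the core, `τ → 0, 2` exactly at the
  disc centre and at normal radius `2`); the inverse `Ψinv` is smooth (`contDiffOn_Ψinv`).

## References

* R. E. Gompf, A. I. Stipsicz, *4-Manifolds and Kirby Calculus*, GSM 20 (1999), §6.2.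
* R. C. Kirby, *The Topology of 4-Manifolds*, LNM 1374 (1989), Ch. I §5. [cite: Kirby1989, Ch. I §5]

## Design notes

* All functions are explicit; only the inverse `Ψinv` is obtained by `Function.invFunOn` (with closed
  forms in the two product regimes, which is all the collar construction needs for its agreement lemmas).
* No declaration in this file uses `sorry`; no local notation, no instances.
-/

open Set Real Function
open scoped ContDiff Topology

noncomputable section

namespace Literature.Topology.FourManifolds

namespace SliceCollar

open TraceCollar

/-! ### The edge functions `E c t = ψ (1/t - 1/c)` -/

/-- The **edge function** `E_c(t) = ψ(1/t - 1/c)`: smooth on `t > 0`, `+∞ ← E_c` as `t → 0⁺`,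
strictly decreasing on `(0, c]`, and identically `0` for `t ≥ c` (flat) [folklore] -/
def E (c t : ℝ) : ℝ := ψ (t⁻¹ - c⁻¹)

/-- `E c t ≥ 0`. [folklore] -/
theorem E_nonneg (c t : ℝ) : 0 ≤ E c t := ψ_nonneg _

/-- `E c t > 0` iff `t < c` (for `t, c > 0`). [folklore] -/
theorem E_pos_iff {c t : ℝ} (hc : 0 < c) (ht : 0 < t) : 0 < E c t ↔ t < c := by
  rw [E, ψ_pos_iff, sub_pos, inv_lt_inv₀ hc ht]

/-- `E c t = 0` iff `c ≤ t` (for `t, c > 0`): `E c` is flat beyond `c`. [folklore] -/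
theorem E_eq_zero_iff {c t : ℝ} (hc : 0 < c) (ht : 0 < t) : E c t = 0 ↔ c ≤ t := by
  rw [E, ψ_eq_zero_iff, sub_nonpos, inv_le_inv₀ ht hc]

/-- `E c t = 0` for `t ≥ c`. [folklore] -/
theorem E_of_le {c t : ℝ} (hc : 0 < c) (ht : 0 < t) (h : c ≤ t) : E c t = 0 := (E_eq_zero_iff hc ht).2 h

/-- `E c t > 0` for `0 < t < c`. [folklore] -/
theorem E_pos {c t : ℝ} (hc : 0 < c) (ht : 0 < t) (h : t < c) : 0 < E c t := (E_pos_iff hc ht).2 h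

/-- The derivative of `E c` [folklore] -/
def dEc (c t : ℝ) : ℝ := -(dψ (t⁻¹ - c⁻¹) * (t ^ 2)⁻¹)

/-- The derivative of `E c` is `dEc c`. [folklore] -/
theorem hasDerivAt_E (c : ℝ) {t : ℝ} (ht : t ≠ 0) : HasDerivAt (E c) (dEc c t) t := by
  have h1 : HasDerivAt (fun t : ℝ ↦ t⁻¹ - c⁻¹) (-(t ^ 2)⁻¹) t := (hasDerivAt_inv ht).sub_const _
  have h2 := (hasDerivAt_ψ (t⁻¹ - c⁻¹)).comp t h1
  have : dEc c t = dψ (t⁻¹ - c⁻¹) * -(t ^ 2)⁻¹ := by rw [dEc]; ring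
  rw [this]
  exact h2

/-- `E c` is non-increasing: `dEc c t ≤ 0`. [folklore] -/
theorem dEc_nonpos (c t : ℝ) : dEc c t ≤ 0 := by
  rw [dEc, neg_nonpos]
  exact mul_nonneg (dψ_nonneg _) (by positivity)

/-- `dEc c t < 0` for `0 < t < c`. [folklore] -/
theorem dEc_neg {c t : ℝ} (hc : 0 < c) (ht : 0 < t) (h : t < c) : dEc c t < 0 := by
  rw [dEc, neg_lt_zero]
  exact mul_pos (dψ_pos (by rw [sub_pos, inv_lt_inv₀ hc ht]; exact h)) (by positivity)

/-- `dEc c t = 0` for `t ≥ c`. [folklore] -/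
theorem dEc_of_le {c t : ℝ} (hc : 0 < c) (ht : 0 < t) (h : c ≤ t) : dEc c t = 0 := by
  rw [dEc, dψ_of_nonpos (by rw [sub_nonpos, inv_le_inv₀ ht hc]; exact h)]
  ring

/-- `E c` is smooth on `(0, ∞)`. [folklore] -/
theorem contDiffOn_E (c : ℝ) : ContDiffOn ℝ ∞ (E c) (Ioi 0) := by
  refine contDiff_ψ.comp_contDiffOn ?_
  exact (contDiffOn_inv ℝ).mono (fun t (ht : 0 < t) ↦ ht.ne') |>.sub contDiffOn_const

/-- `E c` is smooth at every `t > 0`. [folklore] -/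
theorem contDiffAt_E (c : ℝ) {t : ℝ} (ht : 0 < t) : ContDiffAt ℝ ∞ (E c) t :=
  (contDiffOn_E c).contDiffAt (Ioi_mem_nhds ht)

/-- `E c` is continuous on `(0, ∞)`. [folklore] -/
theorem continuousOn_E (c : ℝ) : ContinuousOn (E c) (Ioi 0) := (contDiffOn_E c).continuousOn

/-- `E c` is strictly decreasing on `(0, c]` [folklore] -/
theorem E_lt_E {c t t' : ℝ} (ht : 0 < t) (htt' : t < t') (ht'c : t' ≤ c) : E c t' < E c t := by
  rw [E, E]
  refine strictMonoOn_ψ ?_ ?_ ?_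
  · rw [mem_Ici, sub_nonneg]; exact inv_anti₀ (ht.trans htt') ht'c
  · rw [mem_Ici, sub_nonneg]; exact inv_anti₀ ht (htt'.le.trans ht'c)
  · exact sub_lt_sub_right ((inv_lt_inv₀ (ht.trans htt') ht).2 htt') _

/-- `E c` is injective on `(0, c]` [folklore] -/
theorem E_injOn (c : ℝ) : InjOn (E c) (Ioc 0 c) := by
  intro t ht t' ht' h
  rcases lt_trichotomy t t' with hlt | heq | hgt
  · exact absurd h (E_lt_E ht.1 hlt ht'.2).ne'
  · exact heq
  · exact absurd h (E_lt_E ht'.1 hgt ht.2).ne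

/-- Lower bound `E c t ≥ exp (1/t - 1/c - 1)` for `1/t - 1/c ≥ 1`, giving `E c t → ∞` as `t → 0⁺` [folklore] -/
theorem exp_le_E {c t : ℝ} (h : 1 ≤ t⁻¹ - c⁻¹) : Real.exp (t⁻¹ - c⁻¹ - 1) ≤ E c t := by
  rw [E, ψ_eq_exp (one_pos.trans_le h)]
  exact Real.exp_le_exp.2 (by linarith [inv_le_one_of_one_le₀ h])

/-- The **explicit inverse** of `E c` on `(0, c)`: `Einv c q = 1/(ψinv q + 1/c)` [folklore] -/
def Einv (c q : ℝ) : ℝ := (ψinv q + c⁻¹)⁻¹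

/-- `Einv c q > 0`. [folklore] -/
theorem Einv_pos {c : ℝ} (hc : 0 < c) (q : ℝ) : 0 < Einv c q := by
  rw [Einv, inv_pos]; exact add_pos (ψinv_pos q) (inv_pos.2 hc)

/-- `Einv c q < c`. [folklore] -/
theorem Einv_lt {c : ℝ} (hc : 0 < c) (q : ℝ) : Einv c q < c := by
  rw [Einv]
  have h : c⁻¹ < ψinv q + c⁻¹ := lt_add_of_pos_left _ (ψinv_pos q)
  have := (inv_lt_inv₀ (add_pos (ψinv_pos q) (inv_pos.2 hc)) (inv_pos.2 hc)).2 h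
  rwa [inv_inv] at this

/-- `Einv c q ∈ (0, c)`. [folklore] -/
theorem Einv_mem {c : ℝ} (hc : 0 < c) (q : ℝ) : Einv c q ∈ Ioo 0 c := ⟨Einv_pos hc q, Einv_lt hc q⟩

/-- `E c (Einv c q) = q` for `q > 0`. [folklore] -/
theorem E_Einv (c : ℝ) {q : ℝ} (hq : 0 < q) : E c (Einv c q) = q := by
  rw [E, Einv, inv_inv, add_sub_cancel_right, ψ_ψinv hq]

/-- `Einv c (E c t) = t` for `0 < t < c`. [folklore] -/
theorem Einv_E {c t : ℝ} (hc : 0 < c) (ht : 0 < t) (h : t < c) : Einv c (E c t) = t := by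
  have hY : 0 < t⁻¹ - c⁻¹ := by rw [sub_pos, inv_lt_inv₀ hc ht]; exact h
  rw [Einv, E, ψinv_ψ hY, sub_add_cancel, inv_inv]

/-- `E c` is smooth on `(0, ∞)`. [folklore] -/
theorem contDiffOn_Einv {c : ℝ} (hc : 0 < c) : ContDiffOn ℝ ∞ (Einv c) (Ioi 0) := by
  refine ContDiffOn.inv (contDiffOn_ψinv.add contDiffOn_const) fun q _ ↦ ?_
  exact (add_pos (ψinv_pos q) (inv_pos.2 hc)).ne'

/-- `E c` is smooth at every `t > 0`. [folklore] -/
theorem contDiffAt_Einv {c q : ℝ} (hc : 0 < c) (hq : 0 < q) : ContDiffAt ℝ ∞ (Einv c) q :=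
  (contDiffOn_Einv hc).contDiffAt (Ioi_mem_nhds hq)

/-! ### The profile functions on the L-shaped domain -/

/-- The **L-shaped parameter domain** `P(s) = (0,1) × (0,2) ∖ [s,1) × [1,2)` of pairs `(ℓ, r)`
(depth along the disc, normal radius) outside the compact core [folklore] -/
def P (s : ℝ) : Set (ℝ × ℝ) := {p | 0 < p.1 ∧ p.1 < 1 ∧ 0 < p.2 ∧ p.2 < 2 ∧ ¬(s ≤ p.1 ∧ 1 ≤ p.2)}

/-- The corner `C = (0, s) × (0, 1)` [folklore] -/
def Cor (s : ℝ) : Set (ℝ × ℝ) := Ioo 0 s ×ˢ Ioo 0 1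

/-- The total edge size `F = E_s(ℓ) + E_1(r)` [folklore] -/
def F (s : ℝ) (p : ℝ × ℝ) : ℝ := E s p.1 + E 1 p.2

/-- The **height** `h = -log (E_s(ℓ) + E_1(r))` [folklore] -/
def hgt (s : ℝ) (p : ℝ × ℝ) : ℝ := -Real.log (F s p)

/-- The **angle** `θ = E_1(r)/(E_s(ℓ) + E_1(r)) ∈ [0, 1]` along the level curves of the height [folklore] -/
def θ (s : ℝ) (p : ℝ × ℝ) : ℝ := E 1 p.2 / F s p

/-- The smooth step `β = smoothTransition (2(x - 1/4))`: `0` for `x ≤ 1/4`, `1` for `x ≥ 3/4` [folklore] -/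
def β (x : ℝ) : ℝ := Real.smoothTransition (2 * (x - 4⁻¹))

/-- The **radius rule** `R(r) = r + expNegInvGlue (1 - r)` (`= r` for `r ≥ 1`, increasing, `> 1/e`) [folklore] -/
def R (r : ℝ) : ℝ := r + expNegInvGlue (1 - r)

/-- The **disc rule** `T(ℓ) = (1 - ℓ)/4` [folklore] -/
def T (ℓ : ℝ) : ℝ := (1 - ℓ) / 4

/-- The **tube-radius coordinate** `τ = (1 - β(θ)) R(r) + β(θ) T(ℓ)` [folklore] -/
def τ (s : ℝ) (p : ℝ × ℝ) : ℝ := (1 - β (θ s p)) * R p.2 + β (θ s p) * T p.1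

/-- The **profile map** `Ψ = (τ, h)` [folklore] -/
def Ψ (s : ℝ) (p : ℝ × ℝ) : ℝ × ℝ := (τ s p, hgt s p)

section Basic

variable {s : ℝ}

/-- Membership in the L-shaped domain. [folklore] -/
theorem mem_P_iff {p : ℝ × ℝ} : p ∈ P s ↔ 0 < p.1 ∧ p.1 < 1 ∧ 0 < p.2 ∧ p.2 < 2 ∧ (p.1 < s ∨ p.2 < 1) := by
  simp only [P, mem_setOf_eq, not_and_or, not_le]

/-- The total edge size is positive on the L-shaped domain. [folklore] -/
theorem F_pos (hs : 0 < s) {p : ℝ × ℝ} (hp : p ∈ P s) : 0 < F s p := by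
  obtain ⟨h0, -, h2, -, h⟩ := mem_P_iff.1 hp
  rcases h with h | h
  · exact add_pos_of_pos_of_nonneg (E_pos hs h0 h) (E_nonneg _ _)
  · exact add_pos_of_nonneg_of_pos (E_nonneg _ _) (E_pos one_pos h2 h)

/-- `θ ≥ 0`. [folklore] -/
theorem θ_nonneg (hs : 0 < s) {p : ℝ × ℝ} (hp : p ∈ P s) : 0 ≤ θ s p :=
  div_nonneg (E_nonneg _ _) (F_pos hs hp).le

/-- `θ ≤ 1`. [folklore] -/
theorem θ_le_one (hs : 0 < s) {p : ℝ × ℝ} (hp : p ∈ P s) : θ s p ≤ 1 := by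
  rw [θ, div_le_one (F_pos hs hp), F]
  exact le_add_of_nonneg_left (E_nonneg _ _)

/-- `β ≥ 0`. [folklore] -/
theorem β_nonneg (x : ℝ) : 0 ≤ β x := Real.smoothTransition.nonneg _

/-- `β ≤ 1`. [folklore] -/
theorem β_le_one (x : ℝ) : β x ≤ 1 := Real.smoothTransition.le_one _

/-- `β x = 0` for `x ≤ 1/4`. [folklore] -/
theorem β_of_le {x : ℝ} (hx : x ≤ 4⁻¹) : β x = 0 :=
  Real.smoothTransition.zero_of_nonpos (by linarith)

/-- `β x = 1` for `x ≥ 3/4`. [folklore] -/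
theorem β_of_ge {x : ℝ} (hx : 3 / 4 ≤ x) : β x = 1 :=
  Real.smoothTransition.one_of_one_le (by linarith)

/-- `β` is smooth. [folklore] -/
theorem contDiff_β : ContDiff ℝ ∞ β :=
  Real.smoothTransition.contDiff.comp (contDiff_const.mul (contDiff_id.sub contDiff_const))

/-- `R r = r` for `r ≥ 1`. [folklore] -/
theorem R_of_one_le {r : ℝ} (hr : 1 ≤ r) : R r = r := by
  rw [R, expNegInvGlue.zero_of_nonpos (by linarith), add_zero]

/-- `R` is smooth. [folklore] -/
theorem contDiff_R : ContDiff ℝ ∞ R :=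
  contDiff_id.add (expNegInvGlue.contDiff.comp (contDiff_const.sub contDiff_id))

/-- The derivative of `R` is `1 - expNegInvGlue' (1 - r)`. [folklore] -/
theorem hasDerivAt_R (r : ℝ) : HasDerivAt R (1 - dE (1 - r)) r := by
  have h1 : HasDerivAt (fun r : ℝ ↦ 1 - r) (-1) r := by simpa using (hasDerivAt_id r).const_sub 1
  have h2 := (hasDerivAt_expNegInvGlue (1 - r)).comp r h1
  have h3 := (hasDerivAt_id r).add h2
  show HasDerivAt (fun r : ℝ ↦ r + expNegInvGlue (1 - r)) (1 - dE (1 - r)) r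
  refine h3.congr_deriv ?_
  ring

/-- `R' > 0` (since `expNegInvGlue' < 1`). [folklore] -/
theorem deriv_R_pos (r : ℝ) : 0 < 1 - dE (1 - r) := by linarith [dE_lt_one (1 - r)]

/-- `R` is strictly increasing [folklore] -/
theorem strictMono_R : StrictMono R :=
  strictMono_of_hasDerivAt_pos (fun r ↦ hasDerivAt_R r) fun r ↦ deriv_R_pos r

/-- `exp (-1) < R r` for `r > 0` [folklore] -/
theorem exp_neg_one_lt_R {r : ℝ} (hr : 0 < r) : Real.exp (-1) < R r := by
  have h0 : R 0 = Real.exp (-1) := by simp [R, expNegInvGlue]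
  rw [← h0]; exact strictMono_R hr

/-- `1/4 < exp (-1)` [folklore] -/
theorem quarter_lt_exp_neg_one : (4 : ℝ)⁻¹ < Real.exp (-1) := by
  rw [Real.exp_neg, inv_lt_inv₀ (by norm_num) (Real.exp_pos 1)]
  have := Real.exp_one_lt_d9
  linarith

/-- `T ℓ < 1/4` for `ℓ > 0`. [folklore] -/
theorem T_lt_quarter {ℓ : ℝ} (hℓ : 0 < ℓ) : T ℓ < 4⁻¹ := by rw [T]; linarith

/-- The disc rule is below the radius rule: `T ℓ < R r` for `ℓ, r > 0` [folklore] -/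
theorem T_lt_R {ℓ r : ℝ} (hℓ : 0 < ℓ) (hr : 0 < r) : T ℓ < R r :=
  (T_lt_quarter hℓ).trans (quarter_lt_exp_neg_one.trans (exp_neg_one_lt_R hr))

/-! #### Closed forms in the two product regimes -/

/-- **right regime** (`r ≥ 1`): `Ψ = (R r, -log E_s(ℓ))` [folklore] -/
theorem Ψ_of_one_le (s : ℝ) {p : ℝ × ℝ} (hp : 0 < p.2) (h : 1 ≤ p.2) : Ψ s p = (R p.2, -Real.log (E s p.1)) := by
  have hE : E 1 p.2 = 0 := E_of_le one_pos hp h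
  have hθ : θ s p = 0 := by rw [θ, hE, zero_div]
  simp only [Ψ, τ, hθ, β_of_le (by norm_num : (0 : ℝ) ≤ 4⁻¹), sub_zero, one_mul, zero_mul, add_zero, hgt, F, hE]

/-- **deep regime** (`ℓ ≥ s`): `Ψ = (T ℓ, -log E_1(r))` [folklore] -/
theorem Ψ_of_le (hs : 0 < s) {p : ℝ × ℝ} (hp : 0 < p.1) (h : s ≤ p.1) (hp2 : 0 < p.2) (hr : p.2 < 1) :
    Ψ s p = (T p.1, -Real.log (E 1 p.2)) := by
  have hE : E s p.1 = 0 := E_of_le hs hp h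
  have hE1 : 0 < E 1 p.2 := E_pos one_pos hp2 hr
  have hθ : θ s p = 1 := by rw [θ, F, hE, zero_add, div_self hE1.ne']
  simp only [Ψ, τ, hθ, β_of_ge (by norm_num : (3 : ℝ) / 4 ≤ 1), sub_self, zero_mul, one_mul, zero_add, hgt, F,
    hE]

end Basic

/-! ### Derivatives -/

section Deriv

variable {s : ℝ}

/-- The derivative of Mathlib's `smoothTransition` [folklore] -/
def dsmooth (y : ℝ) : ℝ :=
  (dE y * expNegInvGlue (1 - y) + expNegInvGlue y * dE (1 - y)) / (expNegInvGlue y + expNegInvGlue (1 - y)) ^ 2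

/-- The derivative of Mathlib's `Real.smoothTransition` is `dsmooth`. [folklore] -/
theorem hasDerivAt_smoothTransition (y : ℝ) : HasDerivAt Real.smoothTransition (dsmooth y) y := by
  have h1 := hasDerivAt_expNegInvGlue y
  have h2 : HasDerivAt (fun y : ℝ ↦ expNegInvGlue (1 - y)) (dE (1 - y) * -1) y :=
    HasDerivAt.comp (h₂ := expNegInvGlue) (h := fun y : ℝ ↦ 1 - y) y (hasDerivAt_expNegInvGlue (1 - y))
      (by simpa using (hasDerivAt_id y).const_sub 1)
  have h3 : HasDerivAt (fun y : ℝ ↦ expNegInvGlue y / (expNegInvGlue y + expNegInvGlue (1 - y)))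
      ((dE y * (expNegInvGlue y + expNegInvGlue (1 - y)) - expNegInvGlue y * (dE y + dE (1 - y) * -1)) /
        (expNegInvGlue y + expNegInvGlue (1 - y)) ^ 2) y :=
    h1.div (h1.add h2) (Real.smoothTransition.pos_denom y).ne'
  refine h3.congr_deriv ?_
  rw [dsmooth]
  congr 1
  ring

/-- `smoothTransition' ≥ 0`. [folklore] -/
theorem dsmooth_nonneg (y : ℝ) : 0 ≤ dsmooth y :=
  div_nonneg (add_nonneg (mul_nonneg (dE_nonneg _) (expNegInvGlue.nonneg _))
    (mul_nonneg (expNegInvGlue.nonneg _) (dE_nonneg _))) (sq_nonneg _)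

/-- `smoothTransition' = 0` on `(-∞, 0]`. [folklore] -/
theorem dsmooth_of_nonpos {y : ℝ} (hy : y ≤ 0) : dsmooth y = 0 := by
  rw [dsmooth, dE_of_nonpos hy, expNegInvGlue.zero_of_nonpos hy]; simp

/-- `smoothTransition' = 0` on `[1, ∞)`. [folklore] -/
theorem dsmooth_of_one_le {y : ℝ} (hy : 1 ≤ y) : dsmooth y = 0 := by
  rw [dsmooth, dE_of_nonpos (by linarith : 1 - y ≤ 0), expNegInvGlue.zero_of_nonpos (by linarith : 1 - y ≤ 0)]
  simp

/-- The derivative of `β` [folklore] -/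
def dβ (x : ℝ) : ℝ := 2 * dsmooth (2 * (x - 4⁻¹))

/-- The derivative of `β` is `dβ`. [folklore] -/
theorem hasDerivAt_β (x : ℝ) : HasDerivAt β (dβ x) x := by
  have h1 : HasDerivAt (fun x : ℝ ↦ 2 * (x - 4⁻¹)) 2 x := by
    simpa using ((hasDerivAt_id x).sub_const (4⁻¹ : ℝ)).const_mul (2 : ℝ)
  have h2 := (hasDerivAt_smoothTransition (2 * (x - 4⁻¹))).comp x h1
  refine h2.congr_deriv ?_
  rw [dβ]; ring

/-- `β' ≥ 0`. [folklore] -/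
theorem dβ_nonneg (x : ℝ) : 0 ≤ dβ x := mul_nonneg two_pos.le (dsmooth_nonneg _)

/-- `β' x = 0` for `x ≤ 1/4`. [folklore] -/
theorem dβ_of_le {x : ℝ} (hx : x ≤ 4⁻¹) : dβ x = 0 := by
  rw [dβ, dsmooth_of_nonpos (by linarith), mul_zero]

/-- `β' x = 0` for `x ≥ 3/4`. [folklore] -/
theorem dβ_of_ge {x : ℝ} (hx : 3 / 4 ≤ x) : dβ x = 0 := by
  rw [dβ, dsmooth_of_one_le (by linarith), mul_zero]

/-- `∂F/∂ℓ` [folklore] -/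
def Fl (s : ℝ) (p : ℝ × ℝ) : ℝ := dEc s p.1

/-- `∂F/∂r` [folklore] -/
def Fr (p : ℝ × ℝ) : ℝ := dEc 1 p.2

/-- `∂h/∂ℓ = -F_ℓ/F` [folklore] -/
def hl (s : ℝ) (p : ℝ × ℝ) : ℝ := -(Fl s p) / F s p

/-- `∂h/∂r = -F_r/F` [folklore] -/
def hr (s : ℝ) (p : ℝ × ℝ) : ℝ := -(Fr p) / F s p

/-- `∂θ/∂ℓ = -E₁(r) F_ℓ/F²` [folklore] -/
def θl (s : ℝ) (p : ℝ × ℝ) : ℝ := -(E 1 p.2 * Fl s p) / F s p ^ 2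

/-- `∂θ/∂r = F_r E_s(ℓ)/F²` [folklore] -/
def θr (s : ℝ) (p : ℝ × ℝ) : ℝ := Fr p * E s p.1 / F s p ^ 2

/-- `∂τ/∂ℓ` [folklore] -/
def τl (s : ℝ) (p : ℝ × ℝ) : ℝ := dβ (θ s p) * θl s p * (T p.1 - R p.2) + β (θ s p) * (-4⁻¹)

/-- `∂τ/∂r` [folklore] -/
def τr (s : ℝ) (p : ℝ × ℝ) : ℝ := dβ (θ s p) * θr s p * (T p.1 - R p.2) + (1 - β (θ s p)) * (1 - dE (1 - p.2))

/-- The Jacobian matrix of `Ψ` [folklore] -/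
def Lmat (s : ℝ) (p : ℝ × ℝ) : ℝ × ℝ →L[ℝ] ℝ × ℝ :=
  (τl s p • ContinuousLinearMap.fst ℝ ℝ ℝ + τr s p • ContinuousLinearMap.snd ℝ ℝ ℝ).prod
    (hl s p • ContinuousLinearMap.fst ℝ ℝ ℝ + hr s p • ContinuousLinearMap.snd ℝ ℝ ℝ)

/-- The Jacobian applied to a vector. [folklore] -/
@[simp] theorem Lmat_apply (s : ℝ) (p v : ℝ × ℝ) :
    Lmat s p v = (τl s p * v.1 + τr s p * v.2, hl s p * v.1 + hr s p * v.2) := by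
  simp [Lmat]

/-- Derivative of `F` [folklore] -/
theorem hasFDerivAt_F {p : ℝ × ℝ} (h1 : p.1 ≠ 0) (h2 : p.2 ≠ 0) :
    HasFDerivAt (F s) (Fl s p • ContinuousLinearMap.fst ℝ ℝ ℝ + Fr p • ContinuousLinearMap.snd ℝ ℝ ℝ) p :=
  ((hasDerivAt_E s h1).comp_hasFDerivAt p hasFDerivAt_fst).add
    ((hasDerivAt_E 1 h2).comp_hasFDerivAt p hasFDerivAt_snd)

/-- Derivative of the height [folklore] -/
theorem hasFDerivAt_hgt (hs : 0 < s) {p : ℝ × ℝ} (hp : p ∈ P s) :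
    HasFDerivAt (hgt s) (hl s p • ContinuousLinearMap.fst ℝ ℝ ℝ + hr s p • ContinuousLinearMap.snd ℝ ℝ ℝ) p := by
  obtain ⟨h0, -, h2, -, -⟩ := mem_P_iff.1 hp
  have hF := F_pos hs hp
  have h := ((Real.hasDerivAt_log hF.ne').comp_hasFDerivAt p (hasFDerivAt_F h0.ne' h2.ne')).neg
  refine h.congr_fderiv ?_
  ext <;> simp [hl, hr, div_eq_mul_inv] <;> ring

/-- Derivative of the angle [folklore] -/
theorem hasFDerivAt_θ (hs : 0 < s) {p : ℝ × ℝ} (hp : p ∈ P s) :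
    HasFDerivAt (θ s) (θl s p • ContinuousLinearMap.fst ℝ ℝ ℝ + θr s p • ContinuousLinearMap.snd ℝ ℝ ℝ) p := by
  obtain ⟨h0, -, h2, -, -⟩ := mem_P_iff.1 hp
  have hF := F_pos hs hp
  have hE1 : HasFDerivAt (fun p : ℝ × ℝ ↦ E 1 p.2) (dEc 1 p.2 • ContinuousLinearMap.snd ℝ ℝ ℝ) p :=
    (hasDerivAt_E 1 h2.ne').comp_hasFDerivAt p hasFDerivAt_snd
  have hinv : HasFDerivAt (fun p : ℝ × ℝ ↦ (F s p)⁻¹)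
      ((ContinuousLinearMap.toSpanSingleton ℝ (-(F s p ^ 2)⁻¹)).comp
        (Fl s p • ContinuousLinearMap.fst ℝ ℝ ℝ + Fr p • ContinuousLinearMap.snd ℝ ℝ ℝ)) p :=
    (hasFDerivAt_inv hF.ne').comp p (hasFDerivAt_F (s := s) h0.ne' h2.ne')
  have h : HasFDerivAt (fun p : ℝ × ℝ ↦ E 1 p.2 * (F s p)⁻¹) _ p := hE1.mul hinv
  have heq : (fun p : ℝ × ℝ ↦ E 1 p.2 * (F s p)⁻¹) = θ s := by ext p; rw [θ, div_eq_mul_inv]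
  rw [heq] at h
  refine h.congr_fderiv ?_
  have hF0 : F s p ≠ 0 := hF.ne'
  ext
  · simp [θl, θr, Fl, Fr, div_eq_mul_inv]
    field_simp
  · simp [θl, θr, Fl, Fr, div_eq_mul_inv]
    field_simp
    rw [F]; ring

/-- Derivative of the tube-radius coordinate [folklore] -/
theorem hasFDerivAt_τ (hs : 0 < s) {p : ℝ × ℝ} (hp : p ∈ P s) :
    HasFDerivAt (τ s) (τl s p • ContinuousLinearMap.fst ℝ ℝ ℝ + τr s p • ContinuousLinearMap.snd ℝ ℝ ℝ) p := by
  have hθ' := hasFDerivAt_θ hs hp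
  have hβ := (hasDerivAt_β (θ s p)).comp_hasFDerivAt p hθ'
  have hR : HasFDerivAt (fun p : ℝ × ℝ ↦ R p.2) ((1 - dE (1 - p.2)) • ContinuousLinearMap.snd ℝ ℝ ℝ) p :=
    (hasDerivAt_R p.2).comp_hasFDerivAt p hasFDerivAt_snd
  have hT : HasFDerivAt (fun p : ℝ × ℝ ↦ T p.1) ((-4⁻¹ : ℝ) • ContinuousLinearMap.fst ℝ ℝ ℝ) p := by
    have : HasDerivAt T (-4⁻¹) p.1 := by
      have h0 : HasDerivAt (fun ℓ : ℝ ↦ (1 - ℓ) / 4) (-1 / 4) p.1 := ((hasDerivAt_id p.1).const_sub 1).div_const 4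
      refine (h0.congr_deriv (by norm_num)).congr_of_eventuallyEq ?_
      exact Filter.Eventually.of_forall fun ℓ ↦ rfl
    exact this.comp_hasFDerivAt p hasFDerivAt_fst
  have h : HasFDerivAt (fun p : ℝ × ℝ ↦ (1 - β (θ s p)) * R p.2 + β (θ s p) * T p.1) _ p :=
    ((hβ.const_sub 1).mul hR).add (hβ.mul hT)
  refine h.congr_fderiv ?_
  ext
  · simp [τl, τr]
    ring
  · simp [τl, τr]
    ring

/-- **the derivative of the profile map is `Lmat`** [folklore] -/
theorem hasFDerivAt_Ψ (hs : 0 < s) {p : ℝ × ℝ} (hp : p ∈ P s) : HasFDerivAt (Ψ s) (Lmat s p) p :=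
  (hasFDerivAt_τ hs hp).prodMk (hasFDerivAt_hgt hs hp)

/-! #### Signs of the partial derivatives and the Jacobian determinant -/

/-- The Jacobian determinant `τ_ℓ h_r - τ_r h_ℓ` [folklore] -/
def det (s : ℝ) (p : ℝ × ℝ) : ℝ := τl s p * hr s p - τr s p * hl s p

/-- `F_ℓ ≤ 0`. [folklore] -/
theorem Fl_nonpos (s : ℝ) (p : ℝ × ℝ) : Fl s p ≤ 0 := dEc_nonpos _ _

/-- `F_r ≤ 0`. [folklore] -/
theorem Fr_nonpos (p : ℝ × ℝ) : Fr p ≤ 0 := dEc_nonpos _ _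

/-- `h_ℓ ≥ 0`. [folklore] -/
theorem hl_nonneg (hs : 0 < s) {p : ℝ × ℝ} (hp : p ∈ P s) : 0 ≤ hl s p := by
  rw [hl, neg_div]; exact neg_nonneg.2 (div_nonpos_of_nonpos_of_nonneg (Fl_nonpos s p) (F_pos hs hp).le)

/-- `h_r ≥ 0`. [folklore] -/
theorem hr_nonneg (hs : 0 < s) {p : ℝ × ℝ} (hp : p ∈ P s) : 0 ≤ hr s p := by
  rw [hr, neg_div]; exact neg_nonneg.2 (div_nonpos_of_nonpos_of_nonneg (Fr_nonpos p) (F_pos hs hp).le)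

/-- `h_ℓ > 0` where `ℓ < s`. [folklore] -/
theorem hl_pos (hs : 0 < s) {p : ℝ × ℝ} (hp : p ∈ P s) (hℓ : p.1 < s) : 0 < hl s p := by
  obtain ⟨h0, -, -, -, -⟩ := mem_P_iff.1 hp
  rw [hl, neg_div, neg_pos]
  exact div_neg_of_neg_of_pos (dEc_neg hs h0 hℓ) (F_pos hs hp)

/-- `h_r > 0` where `r < 1`. [folklore] -/
theorem hr_pos (hs : 0 < s) {p : ℝ × ℝ} (hp : p ∈ P s) (hr1 : p.2 < 1) : 0 < hr s p := by
  obtain ⟨-, -, h2, -, -⟩ := mem_P_iff.1 hp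
  rw [hr, neg_div, neg_pos]
  exact div_neg_of_neg_of_pos (dEc_neg one_pos h2 hr1) (F_pos hs hp)

/-- `θ_ℓ ≥ 0`. [folklore] -/
theorem θl_nonneg (s : ℝ) (p : ℝ × ℝ) : 0 ≤ θl s p := by
  rw [θl, neg_div, neg_nonneg]
  exact div_nonpos_of_nonpos_of_nonneg (mul_nonpos_of_nonneg_of_nonpos (E_nonneg _ _) (Fl_nonpos s p)) (sq_nonneg _)

/-- `θ_r ≤ 0`. [folklore] -/
theorem θr_nonpos (s : ℝ) (p : ℝ × ℝ) : θr s p ≤ 0 :=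
  div_nonpos_of_nonpos_of_nonneg (mul_nonpos_of_nonpos_of_nonneg (Fr_nonpos p) (E_nonneg _ _)) (sq_nonneg _)

/-- `T ℓ - R r < 0` on the L-shaped domain. [folklore] -/
theorem T_sub_R_neg {p : ℝ × ℝ} (hp : p ∈ P s) : T p.1 - R p.2 < 0 := by
  obtain ⟨h0, -, h2, -, -⟩ := mem_P_iff.1 hp
  linarith [T_lt_R h0 h2]

/-- `∂τ/∂ℓ ≤ -β(θ)/4 ≤ 0` [folklore] -/
theorem τl_le {p : ℝ × ℝ} (hp : p ∈ P s) : τl s p ≤ β (θ s p) * (-4⁻¹) := by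
  rw [τl]
  have : dβ (θ s p) * θl s p * (T p.1 - R p.2) ≤ 0 :=
    mul_nonpos_of_nonneg_of_nonpos (mul_nonneg (dβ_nonneg _) (θl_nonneg s p)) (T_sub_R_neg hp).le
  linarith

/-- `τ_ℓ ≤ 0`. [folklore] -/
theorem τl_nonpos {p : ℝ × ℝ} (hp : p ∈ P s) : τl s p ≤ 0 :=
  (τl_le hp).trans (mul_nonpos_of_nonneg_of_nonpos (β_nonneg _) (by norm_num))

/-- `∂τ/∂r ≥ (1 - β(θ)) R' ≥ 0` [folklore] -/
theorem le_τr {p : ℝ × ℝ} (hp : p ∈ P s) : (1 - β (θ s p)) * (1 - dE (1 - p.2)) ≤ τr s p := by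
  rw [τr]
  have : 0 ≤ dβ (θ s p) * θr s p * (T p.1 - R p.2) := by
    have h1 : dβ (θ s p) * θr s p ≤ 0 := mul_nonpos_of_nonneg_of_nonpos (dβ_nonneg _) (θr_nonpos s p)
    exact mul_nonneg_of_nonpos_of_nonpos h1 (T_sub_R_neg hp).le
  linarith

/-- `τ_r ≥ 0`. [folklore] -/
theorem τr_nonneg {p : ℝ × ℝ} (hp : p ∈ P s) : 0 ≤ τr s p :=
  (mul_nonneg (sub_nonneg.2 (β_le_one _)) (deriv_R_pos p.2).le).trans (le_τr hp)

/-- Where `β(θ) = 1` the normal radius is `< 1` [folklore] -/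
theorem snd_lt_one_of_θ_pos {p : ℝ × ℝ} (hp : p ∈ P s) (h : 0 < θ s p) : p.2 < 1 := by
  obtain ⟨-, -, h2, -, -⟩ := mem_P_iff.1 hp
  by_contra hr1
  rw [θ, E_of_le one_pos h2 (not_lt.1 hr1), zero_div] at h
  exact lt_irrefl _ h

/-- **the Jacobian determinant is negative** on the L-shaped domain [folklore] -/
theorem det_neg (hs : 0 < s) {p : ℝ × ℝ} (hp : p ∈ P s) : det s p < 0 := by
  have hτl := τl_nonpos hp
  have hτr := τr_nonneg hp
  have hhl := hl_nonneg hs hp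
  have hhr := hr_nonneg hs hp
  rw [det]
  rcases lt_or_ge p.1 s with hℓ | hℓ
  · have hhl' := hl_pos hs hp hℓ
    rcases lt_or_ge (β (θ s p)) 1 with hβ | hβ
    · -- `β < 1`: `τ_r ≥ (1 - β) R' > 0`
      have hτr' : 0 < τr s p := (mul_pos (sub_pos.2 hβ) (deriv_R_pos p.2)).trans_le (le_τr hp)
      nlinarith
    · -- `β = 1`: `τ_ℓ ≤ -1/4 < 0` and `r < 1`
      have hβ1 : β (θ s p) = 1 := le_antisymm (β_le_one _) hβ
      have hθ : 0 < θ s p := by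
        by_contra h
        rw [β_of_le ((not_lt.1 h).trans (by norm_num))] at hβ1
        exact zero_ne_one hβ1
      have hhr' := hr_pos hs hp (snd_lt_one_of_θ_pos hp hθ)
      have hτl' : τl s p < 0 := by have := τl_le hp; rw [hβ1] at this; linarith
      nlinarith
  · -- deep: `r < 1`, `θ = 1`
    obtain ⟨h0, -, h2, -, h⟩ := mem_P_iff.1 hp
    have hr1 : p.2 < 1 := h.resolve_left (not_lt.2 hℓ)
    have hhr' := hr_pos hs hp hr1
    have hθ : θ s p = 1 := by
      rw [θ, F, E_of_le hs h0 hℓ, zero_add, div_self (E_pos one_pos h2 hr1).ne']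
    have hτl' : τl s p < 0 := by
      have := τl_le hp; rw [hθ, β_of_ge (by norm_num : (3 : ℝ) / 4 ≤ 1)] at this; linarith
    nlinarith

/-! #### Smoothness, strict derivative, local invertibility -/

/-- The L-shaped domain is open. [folklore] -/
theorem isOpen_P (s : ℝ) : IsOpen (P s) := by
  have h : P s = (Ioi 0 ×ˢ univ) ∩ (Iio 1 ×ˢ univ) ∩ (univ ×ˢ Ioi 0) ∩ (univ ×ˢ Iio 2) ∩
      ((Iio s ×ˢ univ) ∪ (univ ×ˢ Iio 1)) := by
    ext p; simp only [mem_P_iff, mem_inter_iff, mem_prod, mem_Ioi, mem_Iio, mem_univ, mem_union, and_true, true_and]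
    tauto
  rw [h]
  refine ((((isOpen_Ioi.prod isOpen_univ).inter (isOpen_Iio.prod isOpen_univ)).inter
    (isOpen_univ.prod isOpen_Ioi)).inter (isOpen_univ.prod isOpen_Iio)).inter ?_
  exact (isOpen_Iio.prod isOpen_univ).union (isOpen_univ.prod isOpen_Iio)

/-- The total edge size is smooth on the open quadrant. [folklore] -/
theorem contDiffAt_F {p : ℝ × ℝ} (h1 : 0 < p.1) (h2 : 0 < p.2) : ContDiffAt ℝ ∞ (F s) p :=
  ((contDiffAt_E s h1).comp p contDiffAt_fst).add ((contDiffAt_E 1 h2).comp p contDiffAt_snd)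

/-- The angle is smooth on the L-shaped domain. [folklore] -/
theorem contDiffAt_θ (hs : 0 < s) {p : ℝ × ℝ} (hp : p ∈ P s) : ContDiffAt ℝ ∞ (θ s) p := by
  obtain ⟨h1, -, h2, -, -⟩ := mem_P_iff.1 hp
  exact ((contDiffAt_E 1 h2).comp p contDiffAt_snd).div (contDiffAt_F h1 h2) (F_pos hs hp).ne'

/-- **the profile map is smooth** on the L-shaped domain [folklore] -/
theorem contDiffAt_Ψ (hs : 0 < s) {p : ℝ × ℝ} (hp : p ∈ P s) : ContDiffAt ℝ ∞ (Ψ s) p := by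
  obtain ⟨h1, -, h2, -, -⟩ := mem_P_iff.1 hp
  have hθ' := contDiffAt_θ hs hp
  have hβ : ContDiffAt ℝ ∞ (fun p : ℝ × ℝ ↦ β (θ s p)) p := contDiff_β.contDiffAt.comp p hθ'
  have hR : ContDiffAt ℝ ∞ (fun p : ℝ × ℝ ↦ R p.2) p := contDiff_R.contDiffAt.comp p contDiffAt_snd
  have hT : ContDiffAt ℝ ∞ (fun p : ℝ × ℝ ↦ T p.1) p :=
    ((contDiffAt_const.sub contDiffAt_id).div_const 4).comp p contDiffAt_fst
  have hτ : ContDiffAt ℝ ∞ (τ s) p := ((contDiffAt_const.sub hβ).mul hR).add (hβ.mul hT)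
  have hh : ContDiffAt ℝ ∞ (hgt s) p := ((contDiffAt_F h1 h2).log (F_pos hs hp).ne').neg
  exact hτ.prodMk hh

/-- Strict differentiability of the profile map (it is `C^∞`). [folklore] -/
theorem hasStrictFDerivAt_Ψ (hs : 0 < s) {p : ℝ × ℝ} (hp : p ∈ P s) : HasStrictFDerivAt (Ψ s) (Lmat s p) p := by
  have h := (contDiffAt_Ψ hs hp).hasStrictFDerivAt (by simp)
  rwa [(hasFDerivAt_Ψ hs hp).fderiv] at h

/-- The inverse Jacobian [folklore] -/
def LmatInv (s : ℝ) (p : ℝ × ℝ) : ℝ × ℝ →L[ℝ] ℝ × ℝ :=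
  (det s p)⁻¹ • ((hr s p • ContinuousLinearMap.fst ℝ ℝ ℝ - τr s p • ContinuousLinearMap.snd ℝ ℝ ℝ).prod
    (-(hl s p) • ContinuousLinearMap.fst ℝ ℝ ℝ + τl s p • ContinuousLinearMap.snd ℝ ℝ ℝ))

/-- The inverse Jacobian applied to a vector. [folklore] -/
@[simp] theorem LmatInv_apply (s : ℝ) (p v : ℝ × ℝ) :
    LmatInv s p v = ((det s p)⁻¹ * (hr s p * v.1 - τr s p * v.2), (det s p)⁻¹ * (-(hl s p) * v.1 + τl s p * v.2)) := by
  simp [LmatInv, sub_eq_add_neg]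

/-- **the Jacobian as a continuous linear equivalence** [folklore] -/
def Lequiv (hs : 0 < s) {p : ℝ × ℝ} (hp : p ∈ P s) : (ℝ × ℝ) ≃L[ℝ] (ℝ × ℝ) :=
  ContinuousLinearEquiv.equivOfInverse (Lmat s p) (LmatInv s p)
    (fun v ↦ by
      have hd : det s p ≠ 0 := (det_neg hs hp).ne
      refine Prod.ext ?_ ?_
      · simp only [LmatInv_apply, Lmat_apply]
        field_simp
        rw [det]; ring
      · simp only [LmatInv_apply, Lmat_apply]
        field_simp
        rw [det]; ring)
    (fun v ↦ by
      have hd : det s p ≠ 0 := (det_neg hs hp).ne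
      refine Prod.ext ?_ ?_
      · simp only [LmatInv_apply, Lmat_apply]
        field_simp
        rw [det]; ring
      · simp only [LmatInv_apply, Lmat_apply]
        field_simp
        rw [det]; ring)

/-- The Jacobian equivalence is `Lmat` as a map. [folklore] -/
@[simp] theorem coe_Lequiv (hs : 0 < s) {p : ℝ × ℝ} (hp : p ∈ P s) :
    ((Lequiv hs hp : (ℝ × ℝ) ≃L[ℝ] (ℝ × ℝ)) : (ℝ × ℝ) →L[ℝ] (ℝ × ℝ)) = Lmat s p := rfl

/-- The profile map has an invertible strict derivative on the L-shaped domain. [folklore] -/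
theorem hasStrictFDerivAt_Ψ_equiv (hs : 0 < s) {p : ℝ × ℝ} (hp : p ∈ P s) :
    HasStrictFDerivAt (Ψ s) ((Lequiv hs hp : (ℝ × ℝ) ≃L[ℝ] (ℝ × ℝ)) : (ℝ × ℝ) →L[ℝ] (ℝ × ℝ)) p :=
  hasStrictFDerivAt_Ψ hs hp

/-- **the image of the L-shaped domain is open** [folklore] -/
theorem isOpen_image_Ψ (hs : 0 < s) : IsOpen (Ψ s '' P s) := by
  rw [isOpen_iff_mem_nhds]
  rintro _ ⟨p, hp, rfl⟩
  rw [← HasStrictFDerivAt.map_nhds_eq_of_equiv (hasStrictFDerivAt_Ψ_equiv hs hp)]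
  exact Filter.image_mem_map ((isOpen_P s).mem_nhds hp)

end Deriv

/-! ### Injectivity -/

section Inj

variable {s : ℝ}

/-- **`τ ≥ 1` in the right regime** [folklore] -/
theorem one_le_τ_of_one_le (s : ℝ) {p : ℝ × ℝ} (hp2 : 0 < p.2) (h : 1 ≤ p.2) : 1 ≤ τ s p := by
  have := congrArg Prod.fst (Ψ_of_one_le s hp2 h)
  simp only [Ψ] at this
  rw [this, ← R_of_one_le le_rfl]
  exact strictMono_R.monotone h

/-- **`τ ≤ (1 - s)/4` in the deep regime** [folklore] -/
theorem τ_le_of_le (hs : 0 < s) {p : ℝ × ℝ} (hp : 0 < p.1) (h : s ≤ p.1) (hp2 : 0 < p.2) (hr : p.2 < 1) :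
    τ s p ≤ T s := by
  have := congrArg Prod.fst (Ψ_of_le hs hp h hp2 hr)
  simp only [Ψ] at this
  rw [this, T, T]; linarith

/-- **`(1 - s)/4 < τ < 1` in the corner** [folklore] -/
theorem τ_mem_of_corner {p : ℝ × ℝ} (h0 : 0 < p.1) (hℓ : p.1 < s) (h2 : 0 < p.2) (hr : p.2 < 1) :
    T s < τ s p ∧ τ s p < 1 := by
  have hβ0 := β_nonneg (θ s p)
  have hβ1 := β_le_one (θ s p)
  have hTR : T p.1 < R p.2 := T_lt_R h0 h2
  have hT : T s < T p.1 := by rw [T, T]; linarith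
  have hR : R p.2 < 1 := by rw [← R_of_one_le le_rfl]; exact strictMono_R hr
  rw [τ]
  constructor <;> nlinarith

/-- The derivative of `Einv c` (inverse function rule) [folklore] -/
theorem hasDerivAt_Einv {c q : ℝ} (hc : 0 < c) (hq : 0 < q) :
    HasDerivAt (Einv c) (dEc c (Einv c q))⁻¹ q := by
  have hmem := Einv_mem hc q
  refine HasDerivAt.of_local_left_inverse ((contDiffAt_Einv hc hq).continuousAt)
    (hasDerivAt_E c hmem.1.ne') (dEc_neg hc hmem.1 hmem.2).ne ?_
  filter_upwards [Ioi_mem_nhds hq] with y hy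
  exact E_Einv c hy

/-- Membership in `P` of a corner point [folklore] -/
theorem mem_P_of_corner (hs1 : s < 1) {p : ℝ × ℝ} (hp : p ∈ Ioo 0 s ×ˢ Ioo (0 : ℝ) 1) : p ∈ P s :=
  mem_P_iff.2 ⟨hp.1.1, hp.1.2.trans hs1, hp.2.1, hp.2.2.trans one_lt_two, Or.inl hp.1.2⟩

/-- Equal heights mean equal total edge size [folklore] -/
theorem F_eq_of_hgt_eq (hs : 0 < s) {p p' : ℝ × ℝ} (hp : p ∈ P s) (hp' : p' ∈ P s) (h : hgt s p = hgt s p') :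
    F s p = F s p' := by
  rw [hgt, hgt, neg_inj] at h
  rw [← Real.exp_log (F_pos hs hp), ← Real.exp_log (F_pos hs hp'), h]

/-- **injectivity in the corner**: along a level curve `E_s(ℓ) + E_1(r) = c` of the height, written as
the graph `r = Einv 1 (c - E_s ℓ)`, the coordinate `τ` has derivative `F·det/(-F_r) < 0` [folklore] -/
theorem injOn_Ψ_corner (hs : 0 < s) (hs1 : s < 1) : InjOn (Ψ s) (Ioo 0 s ×ˢ Ioo 0 1) := by
  -- the asymmetric key statement
  have key : ∀ p ∈ Ioo 0 s ×ˢ Ioo (0 : ℝ) 1, ∀ p' ∈ Ioo 0 s ×ˢ Ioo (0 : ℝ) 1,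
      Ψ s p = Ψ s p' → p.1 < p'.1 → False := by
    intro p hp p' hp' h hlt
    have hP := mem_P_of_corner hs1 hp
    have hP' := mem_P_of_corner hs1 hp'
    have hτeq : τ s p = τ s p' := congrArg Prod.fst h
    have hFeq : F s p = F s p' := F_eq_of_hgt_eq hs hP hP' (congrArg Prod.snd h)
    set c := F s p with hc
    -- the level curve as a graph over `ℓ`
    set g : ℝ → ℝ := fun t ↦ Einv 1 (c - E s t) with hg
    have hE1p : E 1 p.2 = c - E s p.1 := by rw [hc, F]; ring
    have hpos : ∀ t ∈ Icc p.1 p'.1, 0 < c - E s t := by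
      intro t ht
      have hEt : E s t ≤ E s p.1 := by
        rcases eq_or_lt_of_le ht.1 with h | h
        · rw [h]
        · exact (E_lt_E hp.1.1 h (ht.2.trans hp'.1.2.le)).le
      have : 0 < E 1 p.2 := E_pos one_pos hp.2.1 hp.2.2
      linarith
    have hga : g p.1 = p.2 := by
      simp only [hg]; rw [← hE1p, Einv_E one_pos hp.2.1 hp.2.2]
    have hgb : g p'.1 = p'.2 := by
      have hE1p' : E 1 p'.2 = c - E s p'.1 := by rw [hFeq, F]; ring
      simp only [hg]; rw [← hE1p', Einv_E one_pos hp'.2.1 hp'.2.2]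
    have hgmem : ∀ t ∈ Icc p.1 p'.1, g t ∈ Ioo (0 : ℝ) 1 := fun t ht ↦ Einv_mem one_pos _
    have hcor : ∀ t ∈ Icc p.1 p'.1, (t, g t) ∈ Ioo 0 s ×ˢ Ioo (0 : ℝ) 1 := fun t ht ↦
      ⟨⟨hp.1.1.trans_le ht.1, ht.2.trans_lt hp'.1.2⟩, hgmem t ht⟩
    -- derivative of the graph and of `τ` along it
    have hgder : ∀ t ∈ Icc p.1 p'.1, HasDerivAt g ((dEc 1 (g t))⁻¹ * -(dEc s t)) t := by
      intro t ht
      have h1 : HasDerivAt (fun t ↦ c - E s t) (-(dEc s t)) t :=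
        (hasDerivAt_E s (hp.1.1.trans_le ht.1).ne').const_sub c
      exact HasDerivAt.comp (h₂ := Einv 1) (h := fun t ↦ c - E s t) t (hasDerivAt_Einv one_pos (hpos t ht)) h1
    set φ : ℝ → ℝ := fun t ↦ τ s (t, g t) with hφ
    set φ' : ℝ → ℝ := fun t ↦ τl s (t, g t) + τr s (t, g t) * ((dEc 1 (g t))⁻¹ * -(dEc s t)) with hφ'
    have hφder : ∀ t ∈ Icc p.1 p'.1, HasDerivAt φ (φ' t) t := by
      intro t ht
      have hPt := mem_P_of_corner hs1 (hcor t ht)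
      have hcurve : HasDerivAt (fun t ↦ ((t, g t) : ℝ × ℝ)) ((1 : ℝ), (dEc 1 (g t))⁻¹ * -(dEc s t)) t :=
        (hasDerivAt_id t).prodMk (hgder t ht)
      have := (hasFDerivAt_τ hs hPt).comp_hasDerivAt t hcurve
      refine this.congr_deriv ?_
      simp [hφ']
    -- the derivative is negative
    have hφ'neg : ∀ t ∈ Icc p.1 p'.1, φ' t < 0 := by
      intro t ht
      have hPt := mem_P_of_corner hs1 (hcor t ht)
      have hdet := det_neg hs hPt
      have hF := F_pos hs hPt
      have hFr : Fr (t, g t) < 0 := dEc_neg one_pos (hgmem t ht).1 (hgmem t ht).2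
      have hFl : dEc s t = Fl s (t, g t) := rfl
      have hFr' : dEc 1 (g t) = Fr (t, g t) := rfl
      -- `φ' = (τl Fr - τr Fl)/Fr` and `τl Fr - τr Fl = -F det > 0`
      have hnum : τl s (t, g t) * Fr (t, g t) - τr s (t, g t) * Fl s (t, g t) = -(F s (t, g t)) * det s (t, g t) := by
        rw [det, hl, hr]; field_simp; ring
      have hnum_pos : 0 < τl s (t, g t) * Fr (t, g t) - τr s (t, g t) * Fl s (t, g t) := by
        rw [hnum]; nlinarith
      have hFr0 : Fr (t, g t) ≠ 0 := hFr.ne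
      have hφ'eq : φ' t = (τl s (t, g t) * Fr (t, g t) - τr s (t, g t) * Fl s (t, g t)) / Fr (t, g t) := by
        simp only [hφ', hFl, hFr']
        field_simp
        ring
      rw [hφ'eq]
      exact div_neg_of_pos_of_neg hnum_pos hFr
    -- mean value theorem
    have hcont : ContinuousOn φ (Icc p.1 p'.1) := fun t ht ↦ (hφder t ht).continuousAt.continuousWithinAt
    obtain ⟨ξ, hξ, hslope⟩ := exists_hasDerivAt_eq_slope φ φ' hlt hcont
      (fun t ht ↦ hφder t (Ioo_subset_Icc_self ht))
    have hφa : φ p.1 = τ s p := by simp only [hφ]; rw [hga]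
    have hφb : φ p'.1 = τ s p' := by simp only [hφ]; rw [hgb]
    rw [hφa, hφb, hτeq, sub_self, zero_div] at hslope
    exact (hφ'neg ξ (Ioo_subset_Icc_self hξ)).ne hslope
  -- symmetrise
  intro p hp p' hp' h
  rcases lt_trichotomy p.1 p'.1 with hlt | heq | hgt
  · exact (key p hp p' hp' h hlt).elim
  · have hP := mem_P_of_corner hs1 hp
    have hP' := mem_P_of_corner hs1 hp'
    have hFeq : F s p = F s p' := F_eq_of_hgt_eq hs hP hP' (congrArg Prod.snd h)
    have hE : E 1 p.2 = E 1 p'.2 := by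
      rw [F, F, heq] at hFeq; linarith
    exact Prod.ext heq (E_injOn 1 ⟨hp.2.1, hp.2.2.le⟩ ⟨hp'.2.1, hp'.2.2.le⟩ hE)
  · exact (key p' hp' p hp h.symm hgt).elim

/-- **the profile map is injective on the L-shaped domain** (the three regimes have disjoint
`τ`-ranges `(0, (1-s)/4]`, `((1-s)/4, 1)`, `[1, 2)`) [folklore] -/
theorem injOn_Ψ (hs : 0 < s) (hs1 : s < 1) : InjOn (Ψ s) (P s) := by
  intro p hp p' hp' h
  obtain ⟨h0, h1, h2, h22, hor⟩ := mem_P_iff.1 hp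
  obtain ⟨h0', h1', h2', h22', hor'⟩ := mem_P_iff.1 hp'
  have hτ : τ s p = τ s p' := congrArg Prod.fst h
  have hF : F s p = F s p' := F_eq_of_hgt_eq hs hp hp' (congrArg Prod.snd h)
  -- classify both points
  rcases le_or_gt 1 p.2 with hr | hr <;> rcases le_or_gt 1 p'.2 with hr' | hr'
  · -- both right
    have e1 := Ψ_of_one_le s h2 hr
    have e2 := Ψ_of_one_le s h2' hr'
    rw [e1, e2] at h
    have hR : p.2 = p'.2 := strictMono_R.injective (congrArg Prod.fst h)
    have hℓ : p.1 < s := hor.resolve_right (not_lt.2 hr)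
    have hℓ' : p'.1 < s := hor'.resolve_right (not_lt.2 hr')
    have hE : E s p.1 = E s p'.1 := by
      rw [F, F, hR] at hF; linarith
    exact Prod.ext (E_injOn s ⟨h0, hℓ.le⟩ ⟨h0', hℓ'.le⟩ hE) hR
  · -- right / not right
    have h1τ : 1 ≤ τ s p := one_le_τ_of_one_le s h2 hr
    rcases lt_or_ge p'.1 s with hℓ' | hℓ'
    · linarith [(τ_mem_of_corner h0' hℓ' h2' hr').2]
    · have := τ_le_of_le hs h0' hℓ' h2' hr'
      have : T s < 1 := by rw [T]; linarith
      linarith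
  · have h1τ : 1 ≤ τ s p' := one_le_τ_of_one_le s h2' hr'
    rcases lt_or_ge p.1 s with hℓ | hℓ
    · linarith [(τ_mem_of_corner h0 hℓ h2 hr).2]
    · have := τ_le_of_le hs h0 hℓ h2 hr
      have : T s < 1 := by rw [T]; linarith
      linarith
  · -- both with `r < 1`: deep or corner
    rcases lt_or_ge p.1 s with hℓ | hℓ <;> rcases lt_or_ge p'.1 s with hℓ' | hℓ'
    · exact injOn_Ψ_corner hs hs1 ⟨⟨h0, hℓ⟩, ⟨h2, hr⟩⟩ ⟨⟨h0', hℓ'⟩, ⟨h2', hr'⟩⟩ h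
    · linarith [(τ_mem_of_corner h0 hℓ h2 hr).1, τ_le_of_le hs h0' hℓ' h2' hr']
    · linarith [(τ_mem_of_corner h0' hℓ' h2' hr').1, τ_le_of_le hs h0 hℓ h2 hr]
    · -- both deep
      have e1 := Ψ_of_le hs h0 hℓ h2 hr
      have e2 := Ψ_of_le hs h0' hℓ' h2' hr'
      rw [e1, e2] at h
      have hT : p.1 = p'.1 := by
        have := congrArg Prod.fst h; rw [T, T] at this; linarith
      have hE : E 1 p.2 = E 1 p'.2 := by
        rw [F, F, hT] at hF; linarith
      exact Prod.ext hT (E_injOn 1 ⟨h2, hr.le⟩ ⟨h2', hr'.le⟩ hE)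

end Inj

/-! ### The image is the open strip `(0, 2) × ℝ` -/

section Image

variable {s : ℝ}

/-- The target strip [folklore] -/
def Strip : Set (ℝ × ℝ) := Ioo 0 2 ×ˢ univ

/-- `T ℓ ≤ τ ≤ R r` [folklore] -/
theorem T_le_τ {p : ℝ × ℝ} (hp : p ∈ P s) : T p.1 ≤ τ s p ∧ τ s p ≤ R p.2 := by
  obtain ⟨h0, -, h2, -, -⟩ := mem_P_iff.1 hp
  have hβ0 := β_nonneg (θ s p)
  have hβ1 := β_le_one (θ s p)
  have hTR : T p.1 < R p.2 := T_lt_R h0 h2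
  rw [τ]; constructor <;> nlinarith

/-- **`Ψ` maps the L-shaped domain into the strip**: `0 < τ < 2` [folklore] -/
theorem Ψ_mem_Strip {p : ℝ × ℝ} (hp : p ∈ P s) : Ψ s p ∈ Strip := by
  obtain ⟨h0, h1, h2, h22, -⟩ := mem_P_iff.1 hp
  obtain ⟨hT, hR⟩ := T_le_τ hp
  refine ⟨⟨?_, ?_⟩, mem_univ _⟩
  · have : 0 < T p.1 := by rw [T]; linarith
    exact this.trans_le hT
  · have : R p.2 < 2 := by
      have h := strictMono_R h22
      rwa [R_of_one_le (by norm_num : (1 : ℝ) ≤ 2)] at h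
    exact hR.trans_lt this

/-- The profile map sends the L-shaped domain into the strip. [folklore] -/
theorem mapsTo_Ψ (s : ℝ) : MapsTo (Ψ s) (P s) Strip := fun _ hp ↦ Ψ_mem_Strip hp

/-- `F = exp (-h)` [folklore] -/
theorem F_eq_exp (hs : 0 < s) {p : ℝ × ℝ} (hp : p ∈ P s) : F s p = Real.exp (-(hgt s p)) := by
  rw [hgt, neg_neg, Real.exp_log (F_pos hs hp)]

/-- `E c tₙ → ∞` when `tₙ → 0⁺` [folklore] -/
theorem tendsto_E_atTop (c : ℝ) {u : ℕ → ℝ} (hu : Filter.Tendsto u Filter.atTop (𝓝 0))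
    (hpos : ∀ n, 0 < u n) : Filter.Tendsto (fun n ↦ E c (u n)) Filter.atTop Filter.atTop := by
  have h1 : Filter.Tendsto (fun n ↦ (u n)⁻¹) Filter.atTop Filter.atTop := by
    have hu' : Filter.Tendsto u Filter.atTop (𝓝[>] 0) :=
      tendsto_nhdsWithin_iff.2 ⟨hu, Filter.Eventually.of_forall hpos⟩
    exact tendsto_inv_nhdsGT_zero.comp hu'
  have h2 : Filter.Tendsto (fun n ↦ Real.exp ((u n)⁻¹ - c⁻¹ - 1)) Filter.atTop Filter.atTop := by
    refine Real.tendsto_exp_atTop.comp ?_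
    have : Filter.Tendsto (fun n ↦ (u n)⁻¹ + (-c⁻¹ - 1)) Filter.atTop Filter.atTop :=
      Filter.tendsto_atTop_add_const_right _ _ h1
    exact this.congr fun n ↦ by ring
  refine Filter.tendsto_atTop_mono' _ ?_ h2
  have hev : ∀ᶠ n in Filter.atTop, 1 + c⁻¹ ≤ (u n)⁻¹ := h1.eventually (Filter.eventually_ge_atTop _)
  filter_upwards [hev] with n hn
  exact exp_le_E (by linarith)

/-- **the image of the L-shaped domain is relatively closed in the strip** [folklore] -/
theorem closure_image_Ψ_inter_subset (hs : 0 < s) (hs1 : s < 1) : closure (Ψ s '' P s) ∩ Strip ⊆ Ψ s '' P s := by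
  rintro q ⟨hq, ⟨hq0, hq2⟩, -⟩
  obtain ⟨u, hu, hlim⟩ := mem_closure_iff_seq_limit.1 hq
  choose x hx hxu using hu
  -- a convergent subsequence of the preimages in the compact box `[0,1] × [0,2]`
  have hbox : ∀ n, x n ∈ Icc (0 : ℝ) 1 ×ˢ Icc (0 : ℝ) 2 := fun n ↦ by
    obtain ⟨h0, h1, h2, h22, -⟩ := mem_P_iff.1 (hx n)
    exact ⟨⟨h0.le, h1.le⟩, ⟨h2.le, h22.le⟩⟩
  obtain ⟨p, -, φ, hφ, hφlim⟩ := (isCompact_Icc.prod isCompact_Icc).tendsto_subseq hbox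
  have hlim' : Filter.Tendsto (fun n ↦ Ψ s (x (φ n))) Filter.atTop (𝓝 q) := by
    have : (fun n ↦ Ψ s (x (φ n))) = u ∘ φ := funext fun n ↦ hxu (φ n)
    rw [this]; exact hlim.comp hφ.tendsto_atTop
  have hτlim : Filter.Tendsto (fun n ↦ τ s (x (φ n))) Filter.atTop (𝓝 q.1) := (continuous_fst.tendsto _).comp hlim'
  have hhlim : Filter.Tendsto (fun n ↦ hgt s (x (φ n))) Filter.atTop (𝓝 q.2) := (continuous_snd.tendsto _).comp hlim'
  have hFlim : Filter.Tendsto (fun n ↦ F s (x (φ n))) Filter.atTop (𝓝 (Real.exp (-q.2))) := by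
    have : (fun n ↦ F s (x (φ n))) = fun n ↦ Real.exp (-(hgt s (x (φ n)))) := funext fun n ↦ F_eq_exp hs (hx _)
    rw [this]; exact (Real.continuous_exp.tendsto _).comp hhlim.neg
  have hℓlim : Filter.Tendsto (fun n ↦ (x (φ n)).1) Filter.atTop (𝓝 p.1) := (continuous_fst.tendsto _).comp hφlim
  have hrlim : Filter.Tendsto (fun n ↦ (x (φ n)).2) Filter.atTop (𝓝 p.2) := (continuous_snd.tendsto _).comp hφlim
  have hP : ∀ n, x (φ n) ∈ P s := fun n ↦ hx _
  -- (i) `ℓ̄ > 0`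
  have hp1 : 0 < p.1 := by
    obtain ⟨⟨h0, -⟩, -⟩ := hbox (φ 0)
    by_contra h
    have hp0 : p.1 = 0 := le_antisymm (not_lt.1 h) (by
      have := hbox (φ 0); exact ge_of_tendsto' hℓlim fun n ↦ (mem_P_iff.1 (hP n)).1.le)
    have hE := tendsto_E_atTop s (hp0 ▸ hℓlim) fun n ↦ (mem_P_iff.1 (hP n)).1
    have hF : Filter.Tendsto (fun n ↦ F s (x (φ n))) Filter.atTop Filter.atTop :=
      Filter.tendsto_atTop_mono (fun n ↦ le_add_of_nonneg_right (E_nonneg _ _)) hE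
    exact not_tendsto_nhds_of_tendsto_atTop hF _ hFlim
  -- (ii) `r̄ > 0`
  have hp2 : 0 < p.2 := by
    by_contra h
    have hp0 : p.2 = 0 := le_antisymm (not_lt.1 h) (ge_of_tendsto' hrlim fun n ↦ (mem_P_iff.1 (hP n)).2.2.1.le)
    have hE := tendsto_E_atTop 1 (hp0 ▸ hrlim) fun n ↦ (mem_P_iff.1 (hP n)).2.2.1
    have hF : Filter.Tendsto (fun n ↦ F s (x (φ n))) Filter.atTop Filter.atTop :=
      Filter.tendsto_atTop_mono (fun n ↦ le_add_of_nonneg_left (E_nonneg _ _)) hE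
    exact not_tendsto_nhds_of_tendsto_atTop hF _ hFlim
  -- (iii) `ℓ̄ < 1`: otherwise eventually deep and `τ = T ℓ → 0`
  have hp1' : p.1 < 1 := by
    by_contra h
    have hp11 : p.1 = 1 := le_antisymm (le_of_tendsto' hℓlim fun n ↦ (mem_P_iff.1 (hP n)).2.1.le) (not_lt.1 h)
    have hev : ∀ᶠ n in Filter.atTop, s < (x (φ n)).1 := hℓlim.eventually (lt_mem_nhds (hp11 ▸ hs1))
    have hτ' : Filter.Tendsto (fun n ↦ τ s (x (φ n))) Filter.atTop (𝓝 (T 1)) := by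
      have hT : Filter.Tendsto (fun n ↦ T (x (φ n)).1) Filter.atTop (𝓝 (T 1)) := by
        have hc : Continuous T := (continuous_const.sub continuous_id).div_const 4
        exact (hc.tendsto 1).comp (hp11 ▸ hℓlim)
      refine hT.congr' ?_
      filter_upwards [hev] with n hn
      obtain ⟨h0, -, h2, -, hor⟩ := mem_P_iff.1 (hP n)
      have hr : (x (φ n)).2 < 1 := hor.resolve_left (not_lt.2 hn.le)
      have := congrArg Prod.fst (Ψ_of_le hs h0 hn.le h2 hr)
      exact this.symm
    have : q.1 = T 1 := tendsto_nhds_unique hτlim hτ'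
    rw [this, T] at hq0; norm_num at hq0
  -- (iv) `r̄ < 2`: otherwise eventually right and `τ = R r → 2`
  have hp2' : p.2 < 2 := by
    by_contra h
    have hp22 : p.2 = 2 := le_antisymm (le_of_tendsto' hrlim fun n ↦ (mem_P_iff.1 (hP n)).2.2.2.1.le) (not_lt.1 h)
    have hev : ∀ᶠ n in Filter.atTop, 1 < (x (φ n)).2 := hrlim.eventually (lt_mem_nhds (by rw [hp22]; norm_num))
    have hτ' : Filter.Tendsto (fun n ↦ τ s (x (φ n))) Filter.atTop (𝓝 (R 2)) := by
      have hR : Filter.Tendsto (fun n ↦ R (x (φ n)).2) Filter.atTop (𝓝 (R 2)) :=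
        (contDiff_R.continuous.tendsto 2).comp (hp22 ▸ hrlim)
      refine hR.congr' ?_
      filter_upwards [hev] with n hn
      obtain ⟨-, -, h2, -, -⟩ := mem_P_iff.1 (hP n)
      exact (congrArg Prod.fst (Ψ_of_one_le s h2 hn.le)).symm
    have : q.1 = R 2 := tendsto_nhds_unique hτlim hτ'
    rw [this, R_of_one_le (by norm_num : (1 : ℝ) ≤ 2)] at hq2
    exact lt_irrefl _ hq2
  -- (v) not in the compact core: otherwise `F → 0`
  have hcont : ContinuousAt (F s) p := (contDiffAt_F hp1 hp2).continuousAt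
  have hFp : F s p = Real.exp (-q.2) := tendsto_nhds_unique (hcont.tendsto.comp hφlim) hFlim
  have hp5 : ¬(s ≤ p.1 ∧ 1 ≤ p.2) := by
    rintro ⟨h1, h2⟩
    have : F s p = 0 := by rw [F, E_of_le hs hp1 h1, E_of_le one_pos hp2 h2, add_zero]
    rw [this] at hFp
    exact (Real.exp_pos _).ne hFp
  have hpP : p ∈ P s := ⟨hp1, hp1', hp2, hp2', hp5⟩
  refine ⟨p, hpP, ?_⟩
  exact tendsto_nhds_unique ((contDiffAt_Ψ hs hpP).continuousAt.tendsto.comp hφlim) hlim'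

/-- **the profile map sends the L-shaped domain onto the strip** [folklore] -/
theorem image_Ψ_eq (hs : 0 < s) (hs1 : s < 1) : Ψ s '' P s = Strip := by
  refine Subset.antisymm (mapsTo_Ψ s).image_subset ?_
  have hconn : IsPreconnected Strip := isPreconnected_Ioo.prod isPreconnected_univ
  refine hconn.subset_of_closure_inter_subset (isOpen_image_Ψ hs) ?_ (closure_image_Ψ_inter_subset hs hs1)
  have hmem : ((s / 2, 1 / 2) : ℝ × ℝ) ∈ P s := mem_P_iff.2 ⟨by positivity, by linarith, by norm_num, by norm_num,
    Or.inr (by norm_num)⟩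
  exact ⟨_, Ψ_mem_Strip hmem, _, hmem, rfl⟩

/-- Surjectivity onto the strip. [folklore] -/
theorem surjOn_Ψ (hs : 0 < s) (hs1 : s < 1) : SurjOn (Ψ s) (P s) Strip := by rw [SurjOn, image_Ψ_eq hs hs1]

/-! #### The inverse profile map -/

/-- **the inverse profile map** `Ψ⁻¹ : (0,2) × ℝ → P(s)` [folklore] -/
def Ψinv (s : ℝ) : ℝ × ℝ → ℝ × ℝ := Function.invFunOn (Ψ s) (P s)

/-- `Ψinv` lands in the L-shaped domain. [folklore] -/
theorem Ψinv_mem (hs : 0 < s) (hs1 : s < 1) {q : ℝ × ℝ} (hq : q ∈ Strip) : Ψinv s q ∈ P s :=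
  Function.invFunOn_mem (surjOn_Ψ hs hs1 hq)

/-- `Ψ ∘ Ψinv = id` on the strip. [folklore] -/
theorem Ψ_Ψinv (hs : 0 < s) (hs1 : s < 1) {q : ℝ × ℝ} (hq : q ∈ Strip) : Ψ s (Ψinv s q) = q :=
  Function.invFunOn_eq (surjOn_Ψ hs hs1 hq)

/-- `Ψinv ∘ Ψ = id` on the L-shaped domain. [folklore] -/
theorem Ψinv_Ψ (hs : 0 < s) (hs1 : s < 1) {p : ℝ × ℝ} (hp : p ∈ P s) : Ψinv s (Ψ s p) = p :=
  (injOn_Ψ hs hs1).leftInvOn_invFunOn hp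

/-- **the inverse profile map is smooth** on the strip [folklore] -/
theorem contDiffAt_Ψinv (hs : 0 < s) (hs1 : s < 1) {q : ℝ × ℝ} (hq : q ∈ Strip) : ContDiffAt ℝ ∞ (Ψinv s) q := by
  set p := Ψinv s q with hpdef
  have hp : p ∈ P s := Ψinv_mem hs hs1 hq
  have hΨp : Ψ s p = q := Ψ_Ψinv hs hs1 hq
  have hcd : ContDiffAt ℝ ∞ (Ψ s) p := contDiffAt_Ψ hs hp
  have hder : HasFDerivAt (Ψ s) ((Lequiv hs hp : (ℝ × ℝ) ≃L[ℝ] (ℝ × ℝ)) : (ℝ × ℝ) →L[ℝ] (ℝ × ℝ)) p :=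
    hasFDerivAt_Ψ hs hp
  have hn : (∞ : ℕ∞ω) ≠ 0 := by simp
  have hstrict := hcd.hasStrictFDerivAt' hder hn
  have hleft : ∀ᶠ x in 𝓝 p, Ψinv s (Ψ s x) = x := by
    filter_upwards [(isOpen_P s).mem_nhds hp] with x hx
    exact Ψinv_Ψ hs hs1 hx
  have huniq := HasStrictFDerivAt.localInverse_unique hstrict hleft
  have hloc : ContDiffAt ℝ ∞ (hcd.localInverse hder hn) (Ψ s p) := hcd.to_localInverse hder hn
  rw [hΨp] at huniq hloc
  exact hloc.congr_of_eventuallyEq huniq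

/-- The strip is open. [folklore] -/
theorem isOpen_Strip : IsOpen Strip := isOpen_Ioo.prod isOpen_univ

/-- `Ψinv` is `C^∞` on the strip. [folklore] -/
theorem contDiffOn_Ψinv (hs : 0 < s) (hs1 : s < 1) : ContDiffOn ℝ ∞ (Ψinv s) Strip := fun _ hq ↦
  (contDiffAt_Ψinv hs hs1 hq).contDiffWithinAt

/-! #### Closed forms of the inverse in the two product regimes -/

/-- **right regime of the inverse**: for `1 ≤ t < 2`, `Ψ⁻¹ (t, σ) = (Einv s (e^{-σ}), t)` [folklore] -/
theorem Ψinv_of_one_le (hs : 0 < s) (hs1 : s < 1) {q : ℝ × ℝ} (h1 : 1 ≤ q.1) (h2 : q.1 < 2) :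
    Ψinv s q = (Einv s (Real.exp (-q.2)), q.1) := by
  have hmem : (Einv s (Real.exp (-q.2)), q.1) ∈ P s := by
    have h := Einv_mem hs (Real.exp (-q.2))
    exact mem_P_iff.2 ⟨h.1, h.2.trans hs1, one_pos.trans_le h1, h2, Or.inl h.2⟩
  have hΨ : Ψ s (Einv s (Real.exp (-q.2)), q.1) = q := by
    rw [Ψ_of_one_le s (one_pos.trans_le h1) h1]
    simp only
    rw [R_of_one_le h1, E_Einv s (Real.exp_pos _), Real.log_exp, neg_neg]
  conv_lhs => rw [← hΨ]
  exact Ψinv_Ψ hs hs1 hmem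

/-- **deep regime of the inverse**: for `0 < t ≤ (1 - s)/4`, `Ψ⁻¹ (t, σ) = (1 - 4t, Einv 1 (e^{-σ}))` [folklore] -/
theorem Ψinv_of_le (hs : 0 < s) (hs1 : s < 1) {q : ℝ × ℝ} (h0 : 0 < q.1) (h : q.1 ≤ T s) :
    Ψinv s q = (1 - 4 * q.1, Einv 1 (Real.exp (-q.2))) := by
  rw [T] at h
  have hr := Einv_mem one_pos (Real.exp (-q.2))
  have hmem : ((1 - 4 * q.1), Einv 1 (Real.exp (-q.2))) ∈ P s :=
    mem_P_iff.2 ⟨by simp only; linarith, by simp only; linarith, hr.1, hr.2.trans one_lt_two, Or.inr hr.2⟩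
  have hΨ : Ψ s ((1 - 4 * q.1), Einv 1 (Real.exp (-q.2))) = q := by
    rw [Ψ_of_le hs (by simp only; linarith) (by simp only; linarith) hr.1 hr.2]
    simp only [T]
    rw [E_Einv 1 (Real.exp_pos _), Real.log_exp, neg_neg]
    exact Prod.ext (by simp only; ring) rfl
  conv_lhs => rw [← hΨ]
  exact Ψinv_Ψ hs hs1 hmem

end Image

end SliceCollar

end Literature.Topology.FourManifolds
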